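/-
Copyright (c) 2026 the pub-hodgecm-mathlib formalisation cell (harness21).  Prover seat hodgecm-mathlib-K2E3-p34 (g2), Track B «K2-LIT», engine E3, unit U4 «Keys»; PART
«U4Keys» socket :182 (U4f-χ₁-ram-one-pos), programme A_pos^{<} (cond(χ₁|_{F×}) < cond χ₁), brick (c2)^{<} «THE TORUS WITNESS AT `w₀` FOR THE TWO-DEPTH GROUP `J_e`» —
this seat's ★ (c2) `K2E3BranchATorusWitnessLevelN` with `J_n ↦ J_e = eA⁻¹(Jg)` (★ D174's concave-exponent level group); dealer K2E3-plan (g5), K2 bus 2026-09-04T22:51Z.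
KERNEL module: THEOREMS ONLY (no definition, no named fact, no `sorry`, no instance, no notation).
-/
import Summits.HodgeConjecture.HodgeConjecture.Theorems.K2E3BranchATorusWitnessCM          -- ★ Z2A-3c (ii) (K2E3-p06 g4): the depth-zero twin `exists_torusWitness` (`b₀ ∈ I`), `exists_torus_mem_inf`, `w₀_mem_K0`, `twist_comp_proj_apply_one`; brings the (G3) frame, ★ `symm_mem_of_mem_inf`, ★ `coe_eA_apply`
import Summits.HodgeConjecture.HodgeConjecture.Theorems.K2E3LowerUnipotentDeepCellCM           -- ★ (ii)^{<}-CM (this seat): `symm_mem_comap_of_mem`; brings ★ D174 `K2E3IwahoriTwoDepthFactorisation.mem_of_diagonal` (integral diagonal elements lie in the model `Jg`) and its letters `e Jg hJg`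
import HarnessLib

/-!
# K2 ∕ E3 «EllipticInputs», unit U4 «Keys» — socket :182 (positive depth), programme A_pos^{<}, brick (c2)^{<}: THE BRANCH-A TORUS WITNESS AT `w₀` FOR THE TWO-DEPTH GROUP
# «`b₀ = d(u, 1, ū⁻¹) ∈ J_e` and `θ(b₀) = χ₁(u) ≠ χ₁(ū⁻¹) = (χδ^{1∕2})(w₀ b₀ w₀⁻¹)`» on `U(Φ₃)(L⁺_v)`, `v` non-split
# [Keys1984 §3, §7 Thm (2); Roche1998 §3–§4; Rogawski1990 §12.1; BruhatTits1972 (6.4.9)]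

Cell hodgecm-mathlib, Track B «K2-LIT», engine E3, crux item H413 = `stmt-HodgeConjecture-24833` (route `HCCMUnconditional`); line `K2_E3_EllipticInputs`, PART «U4Keys»
socket :182 `sig_K2E3KeysThmTwoContractingRamifiedCharOnePosDepth` (Branch A at POSITIVE depth, regime A_pos^{<} of K2E3-p37 (g0)'s memo §9 and this seat's memo
`K2/K2E3-p34/g2/CENSUS-Apos-lt-shells.md`).  `--supports stmt-HodgeConjecture-24833 --as helper`; THEOREMS ONLY; NOT THE PAYER (one input of the A_pos^{<} assembly).

THE POINT.  The cell-family engine ★ `K2E3BranchAContradictionCells` (p861573) runs on A_pos^{<} at `B := J_e = eA⁻¹(Jg)`, the concave-exponent level group of ★ D174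
`K2E3IwahoriTwoDepthFactorisation` (model letters `e Jg hJg`, CM letter `Je (hJe : Je = Jg.comap eA)` of ★ `K2E3IwahoriTwoDepthLettersCM`).  Its witness clause `hwit` at the
representative `r = w₀` (the DEEP∕SHARP big cell, ★ `K2E3LowerUnipotentDeepCellCM`) asks for `b₀ ∈ J_e` with `w₀ b₀ w₀⁻¹ ∈ P` and `θ(b₀) ≠ ((χ∘proj) ⊗ δ^{1∕2})(w₀ b₀ w₀⁻¹)·1`.  The
depth-zero witness `b₀ = d(u_w, 1, (σu_w)⁻¹)` (an INTEGRAL DIAGONAL element) lies in `J_e` for EVERY exponent matrix with `e i i = 0` (★ D174 `mem_of_diagonal`: the off-diagonal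
entries of a diagonal matrix are `0`), and the disagreement `χ₁(u) ≠ χ₁((σu)⁻¹)` is the depth-zero computation verbatim (it only uses `χ₁(u·σu) ≠ 1`).  This is this seat's ★ (c2)
`K2E3BranchATorusWitnessLevelN` with `(gn hgn Jn hJn) ↦ (e Jg hJg Je hJe he0)`, proof replayed (★ `exists_torusWitness` hides its `b₀` behind `∃`):
* §1 `exists_torus_mem_levelGroup` — `∃ b₀ ∈ J_e`, `b₀ ∈ I`, `b₀ ∈ T(L⁺_v)`, `(b₀)₀₀ = u`;
* §2 **`exists_torusWitness_levelGroup`** — ★ `exists_torusWitness`'s statement with the extra conjunct `b₀ ∈ Je`.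
HONEST LABEL: HC_CM is proved only modulo the 7 printed citations (2 remaining named inputs: hLiu418 = stmt-HodgeConjecture-24832, h413 = stmt-HodgeConjecture-24833) until
rung 0 closes; count-neutral — this file does NOT pay the leaf; :182 stays OPEN.

## References
* [Keys1984] D. Keys, *Principal series representations of special unitary groups over local fields*, Compositio Math. 51 (1984), §3, §7 Thm (2).
* [Roche1998] A. Roche, *Types and Hecke algebras for principal series representations of split reductive p-adic groups*, Ann. Sci. ÉNS (4) 31 (1998), §3–§4.
* [Rogawski1990] J. D. Rogawski, *Automorphic Representations of Unitary Groups in Three Variables*, Ann. of Math. Stud. 123 (1990), §12.1 p. 171, §1.10 p. 9.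
* [BruhatTits1972] F. Bruhat, J. Tits, Publ. Math. IHÉS 41 (1972), (4.4.3)–(4.4.4), (6.4.9).
-/

set_option autoImplicit false
-- the mandated namespace has the single-problem summit's repeated segment (`HodgeConjecture.HodgeConjecture`)
set_option linter.dupNamespace false

noncomputable section

open NumberField IsDedekindDomain
open scoped Matrix MatrixGroups WithZero Valued
open Literature.NumberTheory Literature.NumberTheory.Automorphic Literature.NumberTheory.Automorphic.UnitaryGroup
open Literature.NumberTheory.Rogawski1990

namespace Summit.HodgeConjecture.HodgeConjecture.Cruxes.H413.K2E3BranchATorusWitnessLevelGroup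

open Summit.HodgeConjecture.HodgeConjecture.Cruxes.H413
open Summit.HodgeConjecture.HodgeConjecture.Cruxes.H413.K2E3DepthZeroIwahoriCharacterCM
open Summit.HodgeConjecture.HodgeConjecture.Cruxes.H413.K2E3BranchALettersCM
open Summit.HodgeConjecture.HodgeConjecture.Cruxes.H413.K2E3BranchATorusWitnessCM

variable (L : Type) [Field L] [NumberField L] [IsCMField L] (v : HeightOneSpectrum (𝓞 ↥(maximalRealSubfield L)))
  (w : PlacesOver L v) (hw : IsCMField.complexConj L • w.1 = w.1)
  (eA : Gqs L v ≃ₜ* ↥(unitaryGroupOfForm (galAdicCompletionMap (L := L) (IsCMField.complexConj L) hw) ((StdForm.antidiagonal 3).over (w.1.adicCompletion L))))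
  (heA : ∀ g : Gqs L v,
    ((eA g : ↥(unitaryGroupOfForm (galAdicCompletionMap (L := L) (IsCMField.complexConj L) hw) ((StdForm.antidiagonal 3).over (w.1.adicCompletion L)))) :
        GL (Fin 3) (w.1.adicCompletion L)) =
      ((localNonsplitEquiv (IsCMField.complexConj L) (qsForm L) (IsCMField.complexConj_ne_one L) w hw g :
        ↥(unitaryGroupOfForm (galAdicCompletionMap (L := L) (IsCMField.complexConj L) hw) (placeForm (qsForm L) w.1))) : GL (Fin 3) (w.1.adicCompletion L)))
  {ϖ : w.1.adicCompletion L} (hϖ : Valued.v ϖ = WithZero.exp (-1 : ℤ))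
  (g₁ : GL (Fin 3) (w.1.adicCompletion L)) (hg₁ : (g₁ : Matrix (Fin 3) (Fin 3) (w.1.adicCompletion L)) = Matrix.diagonal ![(1 : w.1.adicCompletion L), 1, ϖ])
  (K0 K1 I : Subgroup (Gqs L v))
  (hK0 : K0 = ((glInt 3 (w.1.adicCompletion L)).subgroupOf
    (unitaryGroupOfForm (galAdicCompletionMap (L := L) (IsCMField.complexConj L) hw) ((StdForm.antidiagonal 3).over (w.1.adicCompletion L)))).comap
      eA.toMulEquiv.toMonoidHom)
  (hK1 : K1 = (((glInt 3 (w.1.adicCompletion L)).map (MulAut.conj g₁).toMonoidHom).subgroupOf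
    (unitaryGroupOfForm (galAdicCompletionMap (L := L) (IsCMField.complexConj L) hw) ((StdForm.antidiagonal 3).over (w.1.adicCompletion L)))).comap
      eA.toMulEquiv.toMonoidHom)
  (hI : I = K0 ⊓ K1)
  (e : Fin 3 → Fin 3 → ℕ)
  (Jg : Subgroup ↥(unitaryGroupOfForm (galAdicCompletionMap (L := L) (IsCMField.complexConj L) hw) ((StdForm.antidiagonal 3).over (w.1.adicCompletion L))))
  (hJg : ∀ k : ↥(unitaryGroupOfForm (galAdicCompletionMap (L := L) (IsCMField.complexConj L) hw) ((StdForm.antidiagonal 3).over (w.1.adicCompletion L))),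
    k ∈ Jg ↔ ∀ i j, Valued.v (((k : GL (Fin 3) (w.1.adicCompletion L)) : Matrix (Fin 3) (Fin 3) (w.1.adicCompletion L)) i j) ≤ Valued.v ϖ ^ e i j)
  (Je : Subgroup (Gqs L v)) (hJe : Je = Jg.comap eA.toMulEquiv.toMonoidHom)
  (w₀ : Gqs L v) (hw₀ : Units.val (w₀.val : GL (Fin 3) (LocalRing L v)) = cmLocalForm L 3 v)

/-! ## §1 The torus element `b₀ = d(u_w, 1, (σu_w)⁻¹)` lies in `J_e` (every `e` with `e i i = 0`) -/

include hw heA hϖ hg₁ hK0 hK1 hI hJg hJe in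
set_option maxHeartbeats 400000 in
-- the `Gqs L v` ∕ matrix-subgroup carriers are definitionally equal but unify slowly; measured (default insufficient, 400000 passes)
/-- **`b₀ = d(u_w, 1, (σu_w)⁻¹) ∈ J_e`**: for a unit `u` of `L ⊗ L⁺_v` with `|u_{w′}| = 1` there is `b₀` in the two-depth group `J_e` (letter `hJe`), in `I`, in the diagonal
torus `T(L⁺_v)`, with `(b₀)₀₀ = u` — ★ `exists_torus_mem_inf` with the extra membership `b₀ ∈ J_e`, which holds for every exponent matrix with `e i i = 0` because an integral
DIAGONAL unitary passes the test (★ D174 `mem_of_diagonal`). [cite: Rogawski1990, §1.10 p. 9] [cite: BruhatTits1972, (4.4.3)–(4.4.4), (6.4.9)] [cite: Roche1998, §3] -/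
theorem exists_torus_mem_levelGroup (he0 : ∀ i, e i i = 0) (u : (LocalRing L v)ˣ) (hu : ∀ w' : PlacesOver L v, Valued.v ((u : LocalRing L v) w') = 1) :
    ∃ b₀ : Gqs L v, b₀ ∈ Je ∧ b₀ ∈ I ∧
      (b₀ : ↥(unitaryGroupOfForm (conjLocal L (IsCMField.complexConj L) v) (cmLocalForm L 3 v))) ∈ (cmBorelTriple L 3 v).M ∧
      ((b₀.val : GL (Fin 3) (LocalRing L v)) : Matrix (Fin 3) (Fin 3) (LocalRing L v)) 0 0 = (u : LocalRing L v) := by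
  have hσσ : ∀ x, (galAdicCompletionMap (L := L) (IsCMField.complexConj L) hw) ((galAdicCompletionMap (L := L) (IsCMField.complexConj L) hw) x) = x :=
    galAdicCompletionMap_galAdicCompletionMap_of_smul_eq (IsCMField.complexConj L) w (IsCMField.complexConj_ne_one L) hw
  have hvσ : ∀ x, Valued.v (galAdicCompletionMap (L := L) (IsCMField.complexConj L) hw x) = Valued.v x :=
    fun x => valued_galAdicCompletionMap (L := L) (IsCMField.complexConj L) hw x
  have hα : Valued.v ((u : LocalRing L v) w) = 1 := hu w
  have hα0 : (u : LocalRing L v) w ≠ 0 := fun h => by rw [h, map_zero] at hα; exact zero_ne_one hα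
  obtain ⟨s, hsT, hs⟩ := exists_coe_eq_diag (galAdicCompletionMap (L := L) (IsCMField.complexConj L) hw)
    (rfl : (StdForm.antidiagonal 3).over (w.1.adicCompletion L) = _) hσσ hα0 (β := 1) (by rw [map_one, mul_one])
  -- `s ∈ K₀` (model)
  have hsK0 : s ∈ (glInt 3 (w.1.adicCompletion L)).subgroupOf
      (unitaryGroupOfForm (galAdicCompletionMap (L := L) (IsCMField.complexConj L) hw) ((StdForm.antidiagonal 3).over (w.1.adicCompletion L))) := by
    rw [mem_glInt_subgroupOf_iff _ rfl hvσ, hs]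
    intro i j
    fin_cases i <;> fin_cases j <;> simp [hvσ, hα]
  -- `s ∈ I_w` (model, level `1`)
  have hsI := mem_glInt_inf_conj_glInt_of_v_lt_one _ rfl hvσ hϖ g₁ hg₁ hsK0 (by rw [hs]; simp)
  -- `s ∈ Jg` (model): `s` is an integral DIAGONAL element
  have hsd : ((s : GL (Fin 3) (w.1.adicCompletion L)) : Matrix (Fin 3) (Fin 3) (w.1.adicCompletion L)) =
      Matrix.diagonal ![(u : LocalRing L v) w, 1, ((galAdicCompletionMap (L := L) (IsCMField.complexConj L) hw) ((u : LocalRing L v) w))⁻¹] := by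
    rw [hs]
    ext i j
    fin_cases i <;> fin_cases j <;> simp [Matrix.diagonal]
  have hsJ := K2E3IwahoriTwoDepthFactorisation.mem_of_diagonal (galAdicCompletionMap (L := L) (IsCMField.complexConj L) hw)
    (rfl : (StdForm.antidiagonal 3).over (w.1.adicCompletion L) = _) hvσ e Jg hJg he0 hsK0 hsd
  refine ⟨eA.symm s, K2E3LowerUnipotentDeepCellCM.symm_mem_comap_of_mem L v w hw eA Jg Je hJe hsJ, symm_mem_of_mem_inf L v w hw eA g₁ K0 K1 I hK0 hK1 hI hsI, ?_, ?_⟩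
  · exact (K2E3IwahoriDetection.eA_mem_torusU_iff L v w hw eA heA (eA.symm s)).1 (by rw [ContinuousMulEquiv.apply_symm_apply]; exact hsT)
  · rw [LocalRing.eq_iff_apply_eq (IsCMField.complexConj L) (IsCMField.complexConj_ne_one L) w hw, ← coe_eA_apply L v w hw eA heA (eA.symm s) 0 0,
      ContinuousMulEquiv.apply_symm_apply, hs]
    rfl

/-! ## §2 The two-depth torus witness: `b₀ ∈ J_e`, `w₀ b₀ w₀⁻¹ ∈ P`, `θ(b₀) ≠ (χδ^{1∕2})(w₀ b₀ w₀⁻¹)` -/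

open Classical in
include hw heA hϖ hg₁ hK0 hK1 hI hJg hJe hw₀ in
set_option maxHeartbeats 1600000 in
-- the `U(Φ₃)(L⁺_v)`-valued products are read in two definitionally equal carriers (`Gqs L v` and the matrix subgroup); measured: 400000 times out at `isDefEq`∕`whnf` (class of ★ `exists_torusWitness` ∕ ★ (c2))
/-- **THE WITNESS CLAUSE `hwit` OF THE CELL-FAMILY ENGINE AT THE REPRESENTATIVE `w₀`, TWO-DEPTH GROUP `J_e`.**  For `χ₁ : (L ⊗ L⁺_v)ˣ → ℂˣ` and a unit `u` with `|u_{w′}| = 1` and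
`χ₁(u · σu) ≠ 1` (Branch A), the element `b₀ = d(u, 1, (σu)⁻¹)` (§1) lies in `J_e` (AND in `I`), its `w₀`-conjugate lies in `P`, and the character `θ(b₀) = χ₁((b₀)₀₀) = χ₁(u)`
differs from `((χ∘proj) ⊗ δ^{1∕2})(w₀ b₀ w₀⁻¹)·1 = χ₁((σu)⁻¹)` (`δ^{1∕2} = 1` on the compact `K₀ ∋ w₀ b₀ w₀⁻¹`; ★ `torusEntry_zero_weylConj`).  This is this seat's ★ (c2)
`exists_torusWitness_levelN` with `J_n ↦ J_e` (proof replayed; the depth of `χ₁` plays no role: the witness is a UNIT).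
[cite: Keys1984, §3, §7 Thm (2)] [cite: Roche1998, §3–§4] [cite: Rogawski1990, §12.1 p. 171] [cite: BruhatTits1972, (6.4.9)] -/
theorem exists_torusWitness_levelGroup (he0 : ∀ i, e i i = 0) (χ₁ : (LocalRing L v)ˣ →* ℂˣ) (u : (LocalRing L v)ˣ)
    (hu : ∀ w' : PlacesOver L v, Valued.v ((u : LocalRing L v) w') = 1)
    (hA : χ₁ (u * Units.map (conjLocal L (IsCMField.complexConj L) v : LocalRing L v →* LocalRing L v) u) ≠ 1) :
    ∃ (b₀ : Gqs L v) (hb₀P : ((w₀ * b₀ * w₀⁻¹ : Gqs L v) : ↥(unitaryGroupOfForm (conjLocal L (IsCMField.complexConj L) v) (cmLocalForm L 3 v))) ∈ (cmBorelTriple L 3 v).P),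
      b₀ ∈ Je ∧ b₀ ∈ I ∧
      (if h : IsUnit (((b₀.val : GL (Fin 3) (LocalRing L v)) : Matrix (Fin 3) (Fin 3) (LocalRing L v)) 0 0) then ((χ₁ h.unit : ℂˣ) : ℂ) else 0) ≠
        (haveI := locallyCompactSpace_cmBorelU L 3 v
         (Representation.twist
            (((Representation.trivial ℂ ↥(torusU (conjLocal L (IsCMField.complexConj L) v) (cmLocalForm L 3 v)) ℂ).twist
              (cmTorusCharPair L v χ₁ 1)).comp (cmBorelTriple L 3 v).proj) (rootDeltaChar (cmBorelTriple L 3 v).P))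
          ⟨((w₀ * b₀ * w₀⁻¹ : Gqs L v) : ↥(unitaryGroupOfForm (conjLocal L (IsCMField.complexConj L) v) (cmLocalForm L 3 v))), hb₀P⟩ 1) := by
  haveI := locallyCompactSpace_cmBorelU L 3 v
  obtain ⟨b₀, hb₀J, hb₀I, hb₀M, hb₀00⟩ := exists_torus_mem_levelGroup L v w hw eA heA hϖ g₁ hg₁ K0 K1 I hK0 hK1 hI e Jg hJg Je hJe he0 u hu
  have hJ : cmLocalForm L 3 v = (StdForm.antidiagonal 3).over (LocalRing L v) := cmLocalForm_eq_over L 3 v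
  -- the torus element read in the matrix carrier, its `w₀`-conjugate
  have hconjT : ((w₀ * b₀ * w₀⁻¹ : Gqs L v) : ↥(unitaryGroupOfForm (conjLocal L (IsCMField.complexConj L) v) (cmLocalForm L 3 v))) ∈ torusU (conjLocal L (IsCMField.complexConj L) v) (cmLocalForm L 3 v) :=
    weylConj_mem_torusU (conjLocal L (IsCMField.complexConj L) v) hJ w₀ hw₀
      (⟨b₀, hb₀M⟩ : ↥(torusU (conjLocal L (IsCMField.complexConj L) v) (cmLocalForm L 3 v)))
  have hb₀P : ((w₀ * b₀ * w₀⁻¹ : Gqs L v) : ↥(unitaryGroupOfForm (conjLocal L (IsCMField.complexConj L) v) (cmLocalForm L 3 v))) ∈ (cmBorelTriple L 3 v).P :=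
    torusU_le_borelU (conjLocal L (IsCMField.complexConj L) v) (cmLocalForm L 3 v) hconjT
  refine ⟨b₀, hb₀P, hb₀J, hb₀I, ?_⟩
  -- left-hand side: `θ(b₀) = χ₁(u)`
  have hU : IsUnit (((b₀.val : GL (Fin 3) (LocalRing L v)) : Matrix (Fin 3) (Fin 3) (LocalRing L v)) 0 0) := by rw [hb₀00]; exact Units.isUnit u
  have hunit : hU.unit = u := Units.ext (by rw [IsUnit.unit_spec, hb₀00])
  rw [dif_pos hU, hunit]
  -- right-hand side: `δ^{1/2}(w₀ b₀ w₀⁻¹) · χ₁(torusEntry 0 (proj (w₀ b₀ w₀⁻¹)))`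
  rw [twist_comp_proj_apply_one (cmBorelTriple L 3 v) (cmTorusCharPair L v χ₁ 1) (rootDeltaChar (cmBorelTriple L 3 v).P) ⟨_, hb₀P⟩]
  -- `δ^{1/2} = 1` on the compact `K₀`
  have hlev := F0P3cStCharTSStLevelsTransport.isOpen_isCompact_levels L v w hw eA g₁ K0 K1 I hK0 hK1 hI
  have hw0K : w₀ ∈ K0 := w₀_mem_K0 L v w hw eA heA K0 hK0 w₀ hw₀
  have hb0K : b₀ ∈ K0 := by rw [hI] at hb₀I; exact (Subgroup.mem_inf.1 hb₀I).1
  have hxK : w₀ * b₀ * w₀⁻¹ ∈ K0 := Subgroup.mul_mem _ (Subgroup.mul_mem _ hw0K hb0K) (Subgroup.inv_mem _ hw0K)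
  have hδ : rootDeltaChar (cmBorelTriple L 3 v).P ⟨_, hb₀P⟩ = 1 :=
    rootDeltaChar_eq_one_of_mem_of_isClosed_of_isCompact (cmBorelTriple L 3 v).P
      (isClosed_borelU (conjLocal L (IsCMField.complexConj L) v) (cmLocalForm L 3 v)) (K := K0) hlev.1.2 hxK
  rw [hδ, Units.val_one, one_mul]
  -- the `χ`-value at the conjugated torus element: `χ₁((σu)⁻¹)`
  have hproj : (cmBorelTriple L 3 v).proj ⟨_, hb₀P⟩ = ⟨((w₀ * b₀ * w₀⁻¹ : Gqs L v) : ↥(unitaryGroupOfForm (conjLocal L (IsCMField.complexConj L) v) (cmLocalForm L 3 v))), hconjT⟩ :=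
    proj_weylConj (conjLocal L (IsCMField.complexConj L) v) hJ w₀ hw₀
      (⟨b₀, hb₀M⟩ : ↥(torusU (conjLocal L (IsCMField.complexConj L) v) (cmLocalForm L 3 v)))
  have hentry : torusEntry (conjLocal L (IsCMField.complexConj L) v) (cmLocalForm L 3 v) 0 ⟨((w₀ * b₀ * w₀⁻¹ : Gqs L v) : ↥(unitaryGroupOfForm (conjLocal L (IsCMField.complexConj L) v) (cmLocalForm L 3 v))), hconjT⟩ =
      (Units.map (conjLocal L (IsCMField.complexConj L) v : LocalRing L v →* LocalRing L v) u)⁻¹ := by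
    have h := torusEntry_zero_weylConj (conjLocal L (IsCMField.complexConj L) v) hJ w₀ hw₀
      (⟨b₀, hb₀M⟩ : ↥(torusU (conjLocal L (IsCMField.complexConj L) v) (cmLocalForm L 3 v)))
    have hT0 : torusEntry (conjLocal L (IsCMField.complexConj L) v) (cmLocalForm L 3 v) 0
        (⟨b₀, hb₀M⟩ : ↥(torusU (conjLocal L (IsCMField.complexConj L) v) (cmLocalForm L 3 v))) = u :=
      Units.ext (by rw [coe_torusEntry]; exact hb₀00)
    rw [hT0] at h
    exact h
  rw [show cmTorusCharPair L v χ₁ 1 = torusCharPair (conjLocal L (IsCMField.complexConj L) v) (cmLocalForm L 3 v) hJ 0 χ₁ 1 from rfl,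
    torusCharPair_apply, MonoidHom.one_apply, mul_one, hproj, hentry]
  -- `χ₁(u) ≠ χ₁((σu)⁻¹)` from `χ₁(u · σu) ≠ 1`
  intro heq
  apply hA
  have h1 : χ₁ u = χ₁ (Units.map (conjLocal L (IsCMField.complexConj L) v : LocalRing L v →* LocalRing L v) u)⁻¹ := Units.ext heq
  rw [map_mul, h1, map_inv, inv_mul_cancel]

end Summit.HodgeConjecture.HodgeConjecture.Cruxes.H413.K2E3BranchATorusWitnessLevelGroup

end
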